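import Summits.Ventures.YMGap.RobustBall.PlaquetteFirstMomentResample
import HarnessLib

/-!
# Venture YMGap, track ROBUST-BALL — the plaquette first moment WITHOUT the `1/(2(d-1))` loss, II: the induction

HONEST FRAMING. WHAT THIS IS: a venture file (cell `pub-ymgap`, track Y2, seat rb-p2 g6): LATTICE
statements about Wilson's `SU(N)` lattice gauge theory on `ℤ^d` (DLR description `ymSpecification`,
tree coupling `β`, weight `exp(-β S_W)`), valid at EVERY `β ≥ 0`, for every DLR state. WHAT IT IS NOT:
nothing about the continuum limit, a spectral gap, or a Clay-sense mass gap.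

Part II of two (part I = `PlaquetteFirstMomentResample`: resampling link, privacy, one-step identity and
kernel bound); here the induction through the DLR equation (part D) and the main result (part E).

MAIN RESULT (`integral_sum_plaquetteObs_ge_sum`). For `G ≅ SU(N)` (`IsSpecialUnitaryModel ρ`),
`N ≥ 2`, `d ≥ 2`, every `β ≥ 0`, every Gibbs measure `μ` of the Wilson specification and every link
`e` of `ℤ^d`, writing `D = 4(d-1)Nβ` and `V₀ = ∫_G (Re tr ρ)² dHaar` (`PlaquetteLowerBound.charVariance`):

  `∫ ∑_{p ∋ e} Re tr ρ(U_p) dμ ≥ β e^{-D} V₀ ∑_{k=1}^{2(d-1)} e^{-kD}`.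

rb-p2 g3's `PlaquettePositivity.integral_sum_plaquetteObs_ge` is the `k = 1` term alone
(`β e^{-2D} V₀`); summed over the `2(d-1)` plaquettes through `e` and distributed by symmetry
(`PlaquettePositivity.integral_plaquetteObs_eq`) the new bound gives the plaquette expectation of
every limit state the EXACT leading coefficient `u = β V₀/N` of the strong-coupling series
(`β_W/4` for `SU(2)`, `β_W/(2N²)` for `N ≥ 3`) up to a factor `e^{-O(β)}` — the structural
`1/(2(d-1))` of g3/g5 (the additive `log(2(d-1))` on the ceiling side of the string-tension law) is
gone (file `StringTensionCeilingLinear`).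

MECHANISM (elementary; no expansion, no reflection positivity). Let
`Q_S(η) = ∫ (∑_{p ∈ S} Re tr(ρ(g) ρ(staple_p^e(η))))² dg` for a set `S` of plaquettes through `e`.
Every plaquette `p ∋ e` has a link `f ≠ e` at which the staple is `a·h·b` in the variable `h` at `f`
(`exists_resampling_link`), and two distinct links lie on at most one plaquette
(`eq_of_two_links`), so NO OTHER staple at `e` reads `f` (`staple_update_eq_of_ne`). Resampling `f`
by Haar measure therefore restores one full character variance and keeps the rest:
`∫ Q_S(η^{f ← h}) dh = Q_{S ∖ p}(η) + V₀` (`integral_integral_sq_sum_update`); through the DLR kernel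
at `f` (density `≥ e^{-D}`) and the DLR equation, `∫ Q_S dμ ≥ e^{-D} (∫ Q_{S∖p} dμ + V₀)`, whence by
induction `∫ Q_S dμ ≥ V₀ ∑_{k=1}^{#S} e^{-kD}` (`integral_sq_sum_ge`); the source-response bound of
part I at `e` (`siteAvg_sum_plaquetteObs_ge`: `γ_e P_e ≥ β e^{-D} Q_T`) finishes.

References: E. Seiler, LNP 159 (1982), §2; H.-O. Georgii, *Gibbs Measures and Phase Transitions*
(2011), Remark 1.24. Everything here is proved; no definition, no named fact. [folklore]
-/

noncomputable section

open MeasureTheory Filter Topology Finset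
open Literature.Probability.LatticeModels Literature.Probability.LatticeModels.DobrushinMetric
open Literature.MathematicalPhysics.QuantumLattice Literature.MathematicalPhysics.QuantumFieldTheory

namespace Summit.Ventures.YMGap.RobustBall

namespace PlaquetteFirstMoment

open PlaquettePositivity

section Kernel

variable {d N : ℕ} {G : Type*} [Group G] [TopologicalSpace G] [IsTopologicalGroup G]
  [CompactSpace G] [MeasurableSpace G] [BorelSpace G] [SecondCountableTopology G] [T2Space G]
  (ρ : G →* Matrix (Fin N) (Fin N) ℂ)

/-! ### Part D — the induction through the DLR equation -/

/-- **The squared partial staple form of a DLR state, by induction on the plaquettes.** For every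
Gibbs measure `μ` of the Wilson specification at `β ≥ 0` (`G ≅ SU(N)`, `N ≥ 2`, `d ≥ 2`), every
link `e` and every set `S` of plaquettes through `e`:
`∫ (∫ (∑_{p ∈ S} Re tr(ρ(g) ρ(staple_p^e)))² dg) dμ ≥ V₀ ∑_{k=1}^{#S} e^{-kD}`, `D = 4(d-1)Nβ`
(one private link per plaquette resampled through its DLR kernel, `siteAvg_integral_sq_partial_sum_ge`,
and the DLR equation `∫ γ_f Q dμ = ∫ Q dμ`). [folklore] -/
theorem integral_sq_sum_ge (hρ : IsSpecialUnitaryModel ρ) (hN : 2 ≤ N) (hd : 2 ≤ d)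
    {β : ℝ} (hβ : 0 ≤ β) {μ : Measure (LGConfig d G)} (hμ : μ ∈ ymGibbsMeasures ρ β)
    (e : Literature.MathematicalPhysics.QuantumLattice.ZdEdge d) {S : Finset (ZdPlaquette d)}
    (hS : S ⊆ plaquettesTouching {e}) :
    PlaquetteLowerBound.charVariance ρ *
        ∑ k ∈ Finset.range S.card, Real.exp (-(((k : ℝ) + 1) * (4 * ((d : ℝ) - 1) * N * β))) ≤
      ∫ η, ∫ g, (∑ p ∈ S, (ρ g * ρ (staple p e η)).trace.re) ^ 2 ∂haarProbability G ∂μ := by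
  classical
  have hu := IsSpecialUnitaryModel.mem_unitaryGroup ρ hρ
  have hγ := isSpecification_ymSpecification_of_t2Space (d := d) ρ hρ.1 β
  have hμG := hμ
  rw [mem_ymGibbsMeasures_iff] at hμG
  haveI := hμG.isProbabilityMeasure
  set D : ℝ := 4 * ((d : ℝ) - 1) * N * β with hDdef
  -- the one-link oscillation `β · 2N · #{p ∋ f}` is `D` for every link `f`
  have hDf : ∀ f : Literature.MathematicalPhysics.QuantumLattice.ZdEdge d,
      β * (2 * N * (plaquettesTouching {f}).card) = D := fun f => by
    have hcf : ((plaquettesTouching {f}).card : ℝ) = 2 * ((d : ℝ) - 1) := by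
      rw [Balaban1983to89.Sufficient.card_plaquettesTouching_singleton f]
      have h1 : 1 ≤ d := by omega
      push_cast [Nat.cast_sub h1]
      ring
    rw [hcf, hDdef]; ring
  induction S using Finset.induction_on with
  | empty => simp
  | @insert p₁ S' hp₁S' ih =>
    have hS' : S' ⊆ plaquettesTouching {e} := (Finset.subset_insert _ _).trans hS
    have hep₁ : e ∈ plaquetteEdges p₁ :=
      mem_plaquettesTouching_singleton.1 (hS (Finset.mem_insert_self _ _))
    obtain ⟨f, hfp, hfe, hst⟩ := exists_resampling_link (G := G) p₁ hep₁
    set Q : LGConfig d G → ℝ := fun η' =>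
      ∫ g, (∑ p ∈ insert p₁ S', (ρ g * ρ (staple p e η')).trace.re) ^ 2 ∂haarProbability G with hQ
    set Q' : LGConfig d G → ℝ := fun η' =>
      ∫ g, (∑ p ∈ S', (ρ g * ρ (staple p e η')).trace.re) ^ 2 ∂haarProbability G with hQ'
    have hQm : Measurable Q := measurable_integral_sq_partial_sum ρ hρ.1 e _
    have hQ'm : Measurable Q' := measurable_integral_sq_partial_sum ρ hρ.1 e _
    set M : ℝ := ((insert p₁ S').card * N) ^ 2 with hM
    set M' : ℝ := (S'.card * N) ^ 2 with hM'
    have hQb : ∀ η', |Q η'| ≤ M := fun η' => by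
      rw [abs_of_nonneg (integral_sq_partial_sum_nonneg_le ρ hu e _ η').1]
      exact (integral_sq_partial_sum_nonneg_le ρ hu e _ η').2
    have hQ'b : ∀ η', |Q' η'| ≤ M' := fun η' => by
      rw [abs_of_nonneg (integral_sq_partial_sum_nonneg_le ρ hu e _ η').1]
      exact (integral_sq_partial_sum_nonneg_le ρ hu e _ η').2
    have hiQ : Integrable Q μ :=
      Integrable.of_bound hQm.aestronglyMeasurable M (ae_of_all _ fun η' => by
        rw [Real.norm_eq_abs]; exact hQb η')
    have hiQ' : Integrable Q' μ :=
      Integrable.of_bound hQ'm.aestronglyMeasurable M' (ae_of_all _ fun η' => by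
        rw [Real.norm_eq_abs]; exact hQ'b η')
    -- the kernel bound at `f`, with `(insert p₁ S').erase p₁ = S'`
    have hker : ∀ η', Real.exp (-D) * (Q' η' + PlaquetteLowerBound.charVariance ρ) ≤
        siteAvg (ymSpecification ρ β) f Q η' := fun η' => by
      have h := siteAvg_integral_sq_partial_sum_ge ρ hρ hN hβ hS (Finset.mem_insert_self p₁ S')
        hfp hfe hst η'
      rw [Finset.erase_insert hp₁S', hDf f] at h
      exact h
    -- integrate against `μ` and use the DLR equation
    have hstep : Real.exp (-D) * (∫ η', Q' η' ∂μ + PlaquetteLowerBound.charVariance ρ) ≤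
        ∫ η', Q η' ∂μ := by
      rw [← hμG.integral_integral_eq hγ {f} hiQ]
      have hlhs : Real.exp (-D) * (∫ η', Q' η' ∂μ + PlaquetteLowerBound.charVariance ρ) =
          ∫ η', Real.exp (-D) * (Q' η' + PlaquetteLowerBound.charVariance ρ) ∂μ := by
        rw [integral_const_mul, integral_add hiQ' (integrable_const _)]
        simp only [integral_const, probReal_univ, one_smul]
      rw [hlhs]
      refine integral_mono ((hiQ'.add (integrable_const _)).const_mul _) ?_ fun η' => hker η'
      have hsm : Measurable (siteAvg (ymSpecification ρ β) f Q) := measurable_siteAvg hγ f hQm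
      exact Integrable.of_bound hsm.aestronglyMeasurable M (ae_of_all _ fun η' => by
        rw [Real.norm_eq_abs]; exact abs_siteAvg_le hγ f hQb η')
    -- the arithmetic of the induction
    have ih' := ih hS'
    rw [Finset.card_insert_of_notMem hp₁S', Finset.sum_range_succ']
    have hterm : ∀ k : ℕ, Real.exp (-((((k + 1 : ℕ) : ℝ) + 1) * D)) =
        Real.exp (-D) * Real.exp (-(((k : ℝ) + 1) * D)) := fun k => by
      rw [← Real.exp_add]; push_cast; ring_nf
    simp_rw [hterm, ← Finset.mul_sum]
    have h0 : Real.exp (-((((0 : ℕ) : ℝ) + 1) * D)) = Real.exp (-D) := by norm_num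
    rw [h0]
    have hV := (PlaquetteLowerBound.charVariance_pos ρ hρ.1 (by omega)).le
    have hexp := Real.exp_nonneg (-D)
    calc PlaquetteLowerBound.charVariance ρ *
          (Real.exp (-D) * ∑ k ∈ Finset.range S'.card, Real.exp (-(((k : ℝ) + 1) * D)) +
            Real.exp (-D))
        = Real.exp (-D) * (PlaquetteLowerBound.charVariance ρ *
            ∑ k ∈ Finset.range S'.card, Real.exp (-(((k : ℝ) + 1) * D)) +
              PlaquetteLowerBound.charVariance ρ) := by ring
      _ ≤ Real.exp (-D) * (∫ η', Q' η' ∂μ + PlaquetteLowerBound.charVariance ρ) :=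
          mul_le_mul_of_nonneg_left (by linarith [ih']) hexp
      _ ≤ ∫ η', Q η' ∂μ := hstep

/-! ### Part E — the first moment of the plaquette sum through a link -/

/-- **THE PLAQUETTE SUM THROUGH A LINK, WITHOUT THE `1/(2(d-1))` LOSS.** For every Gibbs measure
`μ` of the Wilson specification at `β ≥ 0` (`G ≅ SU(N)`, `N ≥ 2`, `d ≥ 2`) and every link `e`:
`∫ ∑_{p ∋ e} Re tr ρ(U_p) dμ ≥ β e^{-D} V₀ ∑_{k=1}^{2(d-1)} e^{-kD}`, `D = 4(d-1)Nβ`,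
`V₀ = charVariance ρ` (source response at `e`, part I, then `integral_sq_sum_ge` with
`#{p ∋ e} = 2(d-1)`). The `k = 1` term alone is rb-p2 g3's `integral_sum_plaquetteObs_ge`.
[folklore] -/
theorem integral_sum_plaquetteObs_ge_sum (hρ : IsSpecialUnitaryModel ρ) (hN : 2 ≤ N) (hd : 2 ≤ d)
    {β : ℝ} (hβ : 0 ≤ β) {μ : Measure (LGConfig d G)} (hμ : μ ∈ ymGibbsMeasures ρ β)
    (e : Literature.MathematicalPhysics.QuantumLattice.ZdEdge d) :
    β * Real.exp (-(4 * ((d : ℝ) - 1) * N * β)) * PlaquetteLowerBound.charVariance ρ *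
        ∑ k ∈ Finset.range (2 * (d - 1)), Real.exp (-(((k : ℝ) + 1) * (4 * ((d : ℝ) - 1) * N * β))) ≤
      ∫ U, ∑ p ∈ plaquettesTouching {e}, plaquetteObs ρ p.1 p.2.1.1 p.2.1.2 U ∂μ := by
  classical
  have hu := IsSpecialUnitaryModel.mem_unitaryGroup ρ hρ
  have hγ := isSpecification_ymSpecification_of_t2Space (d := d) ρ hρ.1 β
  have hμG := hμ
  rw [mem_ymGibbsMeasures_iff] at hμG
  haveI := hμG.isProbabilityMeasure
  set T := plaquettesTouching {e} with hT
  set Q : LGConfig d G → ℝ := fun η' =>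
    ∫ g, (∑ p ∈ T, (ρ g * ρ (staple p e η')).trace.re) ^ 2 ∂haarProbability G with hQ
  set P : LGConfig d G → ℝ := fun U => ∑ p ∈ T, plaquetteObs ρ p.1 p.2.1.1 p.2.1.2 U with hP
  have hQm : Measurable Q := measurable_integral_sq_partial_sum ρ hρ.1 e T
  have hPm : Measurable P :=
    Finset.measurable_sum _ fun p _ => (continuous_plaquetteObs ρ hρ.1 _ _ _).measurable
  set M : ℝ := T.card * N with hM
  have hPb : ∀ U, |P U| ≤ M := fun U => by
    calc |P U| ≤ ∑ p ∈ T, |plaquetteObs ρ p.1 p.2.1.1 p.2.1.2 U| := Finset.abs_sum_le_sum_abs _ _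
      _ ≤ ∑ _p ∈ T, (N : ℝ) := Finset.sum_le_sum fun p _ =>
          abs_re_trace_le_of_mem_unitaryGroup (hu _)
      _ = M := by rw [Finset.sum_const, nsmul_eq_mul]
  have hQb : ∀ η', |Q η'| ≤ M ^ 2 := fun η' => by
    rw [abs_of_nonneg (integral_sq_partial_sum_nonneg_le ρ hu e T η').1]
    exact (integral_sq_partial_sum_nonneg_le ρ hu e T η').2
  -- Step 1: `∫ Q dμ ≥ V₀ ∑ e^{-kD}`
  have hQ1 := integral_sq_sum_ge ρ hρ hN hd hβ hμ e (subset_refl T)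
  -- Step 2: `∫ P dμ = ∫ γ_e P dμ ≥ β e^{-2βM} ∫ Q dμ`
  have hiP : Integrable P μ :=
    Integrable.of_bound hPm.aestronglyMeasurable M (ae_of_all _ fun U => by
      rw [Real.norm_eq_abs]; exact hPb U)
  have hiQ : Integrable Q μ :=
    Integrable.of_bound hQm.aestronglyMeasurable (M ^ 2) (ae_of_all _ fun η' => by
      rw [Real.norm_eq_abs]; exact hQb η')
  have hP1 : β * Real.exp (-(2 * β * M)) * ∫ η, Q η ∂μ ≤ ∫ U, P U ∂μ := by
    rw [← hμG.integral_integral_eq hγ {e} hiP, ← integral_const_mul]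
    refine integral_mono (hiQ.const_mul _) ?_ fun η => siteAvg_sum_plaquetteObs_ge ρ hρ hN hβ e η
    have hsm : Measurable (siteAvg (ymSpecification ρ β) e P) := measurable_siteAvg hγ e hPm
    exact Integrable.of_bound hsm.aestronglyMeasurable M (ae_of_all _ fun η => by
      rw [Real.norm_eq_abs]; exact abs_siteAvg_le hγ e hPb η)
  -- Step 3: the counting `#{p ∋ e} = 2(d-1)`
  have hce : (T.card : ℝ) = 2 * ((d : ℝ) - 1) := by
    rw [hT, Balaban1983to89.Sufficient.card_plaquettesTouching_singleton e]
    have h1 : 1 ≤ d := by omega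
    push_cast [Nat.cast_sub h1]
    ring
  have hcard : T.card = 2 * (d - 1) := by
    rw [hT, Balaban1983to89.Sufficient.card_plaquettesTouching_singleton e]
  have hexp : Real.exp (-(4 * ((d : ℝ) - 1) * N * β)) = Real.exp (-(2 * β * M)) := by
    rw [hM, hce]; ring_nf
  rw [hexp, ← hcard]
  have hsum0 : 0 ≤ ∑ k ∈ Finset.range T.card,
      Real.exp (-(((k : ℝ) + 1) * (4 * ((d : ℝ) - 1) * N * β))) :=
    Finset.sum_nonneg fun k _ => Real.exp_nonneg _
  calc β * Real.exp (-(2 * β * M)) * PlaquetteLowerBound.charVariance ρ *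
        ∑ k ∈ Finset.range T.card, Real.exp (-(((k : ℝ) + 1) * (4 * ((d : ℝ) - 1) * N * β)))
      = β * Real.exp (-(2 * β * M)) * (PlaquetteLowerBound.charVariance ρ *
          ∑ k ∈ Finset.range T.card, Real.exp (-(((k : ℝ) + 1) * (4 * ((d : ℝ) - 1) * N * β)))) := by
        ring
    _ ≤ β * Real.exp (-(2 * β * M)) * ∫ η, Q η ∂μ :=
        mul_le_mul_of_nonneg_left hQ1 (by positivity)
    _ ≤ ∫ U, P U ∂μ := hP1

end Kernel

end PlaquetteFirstMoment

end Summit.Ventures.YMGap.RobustBall
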